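import Summits.Ventures.DiscreteObjects.Hadamard.Order167InvertingOrderFour668
import Summits.Ventures.DiscreteObjects.Hadamard.Order4Nega

/-!
# H(668): EVERY automorphism inverting an element of order 167 is a pair-involution — the normaliser of `⟨σ₁₆₇⟩` contains no
# element of pair order 4, and `N(⟨σ⟩)/±⟨σ⟩` has exponent 2 (kernel exclusion of a symmetry type)

Framing: lottery ticket; floor = certified bounds/negative ranges.

Cell pub-namedobj (venture DiscreteObjects), target (H), hadamard gen 22.  Gen 21 (`Order167NormalizerSmall668`): an element of
`N(⟨σ⟩)`, `σ = (π, κ, d, e)` a signed automorphism of pair order `167` of a Hadamard matrix of order `668`, has pair order `1, 2, 4,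
167` or `334`.  Gen 22 so far (`Order167InvertingOrderFour668`): an INVERTING element of pair order `4` would cycle the four blocks,
with `ρ²` mapping no row and no column into its own `σ`-orbit — in particular `ρ²` is fixed-point-free on rows AND columns.  But
gen 13 (`no_hadamard668_aut_order4_sq_fpf`, `Order4Nega`): the square of an automorphism of pair exponent `4` of an H(668) is
NEVER fixed-point-free on both sides (it would be a nega involution, and nega squares are impossible at order `668 ≡ 4 (mod 8)`).
Hence:
* **`hadamard668_order167_inverting_sq_eq_one`**: **every signed automorphism `ρ = (π', κ', d', e')` inverting `σ`
  (`π'π = π^μ π'`, `κ'κ = κ^μ κ'`, `μ ≡ 166 (mod 167)`) is a pair-involution: `π'² = κ'² = 1`** — unconditionally (no hypothesis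
  on the centraliser) [pair order `1`: impossible (`π ≠ π⁻¹`); `4`: the argument above; `167`: `ρ¹⁶⁷` would be a trivial
  inverting element; `334`: `ρ² = σ^{84c}` would preserve every orbit, so `ρ² = 1` by `inverting_sq_eq_one_of_sq_mem_orbFin`].
* **`hadamard668_order167_inverting_all_or_none`**: so gen 21's all-or-none theorem holds for EVERY inverting element: it
  preserves all four row blocks and all four column blocks with exactly `4 + 4` fixed points, or no block at all, fixed-point-free
  and nega.
* **`hadamard668_order167_normalizer_orderOf_mem'`**: the pair order of ANY element of `N(⟨σ⟩)` (any multiplier) is `1, 2, 167`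
  or `334` — **pair order 4 does not occur in the normaliser of an element of order 167** (sharpens gen 21's list); with gen 21
  (`C(σ)/⟨σ⟩` of exponent `2`, `N/C ≤ C₂`) the quotient `N(⟨σ⟩)/±⟨σ⟩` has exponent `2`: it is elementary abelian of order
  `1, 2, 4` or `8` (paper remark on these kernel facts).
STRUCTURE / EXCLUSION of a symmetry type of a hypothetical object (like gen 20's Frobenius exclusions); no Hadamard order is
excluded; H(668) untouched; HITS 0/4.  Ours; no `sorry`, no definitions, default heartbeats.
-/

namespace Summit.Ventures.DiscreteObjects.Hadamard

open Finset BigOperators Matrix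

open Literature.Combinatorics.Designs.GoethalsSeidel (IsHadamardMatrix)

variable {ι : Type*} [Fintype ι] [DecidableEq ι]

section main
variable {H : Matrix ι ι ℤ} (hH : IsHadamardMatrix H) (hι : Fintype.card ι = 668)
  {π κ π' κ' : Equiv.Perm ι} {d e d' e' : ι → ℤ} (haut : IsSignedAut H π κ d e)
  (hπ : π ^ 167 = 1) (hκ : κ ^ 167 = 1) (hne : π ≠ 1 ∨ κ ≠ 1)
  (haut' : IsSignedAut H π' κ' d' e') {μ : ℕ} (hnπ : π' * π = π ^ μ * π') (hnκ : κ' * κ = κ ^ μ * κ')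
include hH hι haut hπ hκ hne haut' hnπ hnκ

/-- **Every automorphism inverting an element of order 167 is a pair-involution.** -/
theorem hadamard668_order167_inverting_sq_eq_one (hμ : μ % 167 = 166) : π' ^ 2 = 1 ∧ κ' ^ 2 = 1 := by
  by_contra hsq
  rw [not_and_or] at hsq
  obtain ⟨-, hr2⟩ := inverting_order4_rows hH hι haut hπ hκ hne haut' hnπ hnκ hμ hsq
  obtain ⟨-, hc2⟩ := inverting_order4_cols hH hι haut hπ hκ hne haut' hnπ hnκ hμ hsq
  have p0 : (0 : ℕ) < 167 := by norm_num
  -- ρ² fixes no row and no column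
  have hπ2 : ∀ i, π' (π' i) ≠ i := fun i hi => hr2 i (by
    rw [pow_two, Equiv.Perm.mul_apply, hi]; exact mem_orbFin_self π p0 i)
  have hκ2 : ∀ j, κ' (κ' j) ≠ j := fun j hj => hc2 j (by
    rw [pow_two, Equiv.Perm.mul_apply, hj]; exact mem_orbFin_self κ p0 j)
  have hmem := hadamard668_order167_normalizer_orderOf_mem hH hι haut hπ hκ hne haut' hnπ hnκ
  simp only [Finset.mem_insert, Finset.mem_singleton] at hmem
  rcases hmem with h | h | h | h | h
  · -- pair order 1
    have h1 : ((π', κ') : Equiv.Perm ι × Equiv.Perm ι) = 1 := orderOf_eq_one_iff.mp h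
    rw [Prod.mk_eq_one] at h1
    exact inverting_fst_ne_one hH hι haut hπ hκ hne hnπ hμ h1.1
  · -- pair order 2
    obtain ⟨h1, h2, -⟩ := pow_data_of_orderOf h (a := 1) one_pos (by norm_num)
    rcases hsq with h' | h'
    · exact h' h1
    · exact h' h2
  · -- pair order 4: the square would be a fixed-point-free automorphism of exponent 2 on both sides
    obtain ⟨h1, h2, -⟩ := pow_data_of_orderOf h (a := 1) one_pos (by norm_num)
    have e4 : ∀ i, π' (π' (π' (π' i))) = i := by
      intro i
      have h3 := congrArg (fun f : Equiv.Perm ι => f i) h1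
      simpa only [pow_succ, pow_zero, one_mul, Equiv.Perm.mul_apply, Equiv.Perm.one_apply] using h3
    have e4' : ∀ j, κ' (κ' (κ' (κ' j))) = j := by
      intro j
      have h3 := congrArg (fun f : Equiv.Perm ι => f j) h2
      simpa only [pow_succ, pow_zero, one_mul, Equiv.Perm.mul_apply, Equiv.Perm.one_apply] using h3
    exact no_hadamard668_aut_order4_sq_fpf hH hι haut' e4 e4' hπ2 hκ2
  · -- pair order 167: ρ^167 is a trivial inverting element
    obtain ⟨h1, -, -⟩ := pow_data_of_orderOf h (a := 1) one_pos (by norm_num)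
    have hμ' : μ ^ 167 % 167 = 166 := by
      rw [Nat.pow_mod, hμ]
    exact inverting_fst_ne_one hH hι haut hπ hκ hne (norm_pow_left hnπ 167) hμ' h1
  · -- pair order 334: ρ² = σ^{84c} preserves every orbit
    obtain ⟨h334, -, -⟩ := pow_data_of_orderOf h (a := 1) one_pos (by norm_num)
    obtain ⟨c, hc4, -⟩ := hadamard668_order167_normalizer_pow4_mem hH hι haut hπ hκ hne haut' hnπ hnκ
    have e : π' ^ 2 = π ^ (84 * c) := by
      calc π' ^ 2 = π' ^ 334 * π' ^ 2 := by rw [h334, one_mul]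
        _ = (π' ^ 4) ^ 84 := by rw [← pow_add, ← pow_mul]
        _ = π ^ (84 * c) := by rw [hc4, ← pow_mul, mul_comm]
    obtain ⟨x⟩ : Nonempty ι := Fintype.card_pos_iff.mp (by rw [hι]; norm_num)
    exact hr2 x (by rw [e]; exact pow_apply_mem_orbFin π p0 hπ x _)

/-- **All-or-none for EVERY inverting element** (gen 21's theorem without the involution hypothesis): an automorphism inverting
`σ` preserves every row block and every column block, fixing exactly `4` rows and `4` columns, or preserves no block, is
fixed-point-free and nega. -/
theorem hadamard668_order167_inverting_all_or_none (hμ : μ % 167 = 166) :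
    ((∀ x, π' x ∈ orbFin π 167 x) ∧ (∀ y, κ' y ∈ orbFin κ 167 y) ∧
      (univ.filter fun x => π' x = x).card = 4 ∧ (univ.filter fun y => κ' y = y).card = 4) ∨
    ((∀ x, π' x ∉ orbFin π 167 x) ∧ (∀ y, κ' y ∉ orbFin κ 167 y) ∧
      (univ.filter fun x => π' x = x).card = 0 ∧ (univ.filter fun y => κ' y = y).card = 0 ∧
      (∀ i, d' (π' i) = -d' i) ∧ (∀ j, e' (κ' j) = -e' j)) := by
  obtain ⟨h2, h2'⟩ := hadamard668_order167_inverting_sq_eq_one hH hι haut hπ hκ hne haut' hnπ hnκ hμ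
  exact hadamard668_order167_inverting_involution hH hι haut hπ hκ hne haut' hnπ hnκ hμ h2 h2'
    (Or.inl (inverting_fst_ne_one hH hι haut hπ hκ hne hnπ hμ))

/-- **Pair orders in the normaliser of an element of order 167 are `1, 2, 167` or `334`** (any multiplier; order `4` excluded). -/
theorem hadamard668_order167_normalizer_orderOf_mem' :
    orderOf ((π', κ') : Equiv.Perm ι × Equiv.Perm ι) ∈ ({1, 2, 167, 334} : Finset ℕ) := by
  rcases hadamard668_order167_normalizer_dichotomy hH hι haut hπ hκ hne haut' hnπ hnκ with ⟨hc, hc'⟩ | hμ'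
  · have hdvd := centralizer167_orderOf_dvd hH hι haut hπ hκ hne haut' hc hc'
    have hmem : orderOf ((π', κ') : Equiv.Perm ι × Equiv.Perm ι) ∈ Nat.divisors 334 :=
      Nat.mem_divisors.mpr ⟨hdvd, by norm_num⟩
    have hdiv : Nat.divisors 334 = {1, 2, 167, 334} := by decide
    rwa [hdiv] at hmem
  · have hμ : μ % 167 = 166 := by
      rw [← zmod167_166, ZMod.natCast_eq_natCast_iff'] at hμ'
      simpa using hμ'
    obtain ⟨h2, h2'⟩ := hadamard668_order167_inverting_sq_eq_one hH hι haut hπ hκ hne haut' hnπ hnκ hμ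
    have hdvd : orderOf ((π', κ') : Equiv.Perm ι × Equiv.Perm ι) ∣ 2 := by
      apply orderOf_dvd_of_pow_eq_one
      rw [Prod.pow_mk, Prod.mk_eq_one]; exact ⟨h2, h2'⟩
    have hmem : orderOf ((π', κ') : Equiv.Perm ι × Equiv.Perm ι) ∈ Nat.divisors 2 := Nat.mem_divisors.mpr ⟨hdvd, by norm_num⟩
    have hdiv : Nat.divisors 2 = {1, 2} := by decide
    rw [hdiv] at hmem
    simp only [Finset.mem_insert, Finset.mem_singleton] at hmem ⊢
    omega

end main

end Summit.Ventures.DiscreteObjects.Hadamard
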